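import Summits.AtomisticToContinuum.HydrodynamicLimit.Theorems.OneFlightGossipEngineUniformLocalGibbsConcentrationFields
import HarnessLib

/-!
# General `(ε_N, n_N)` families of the canonical hard-sphere gas, IV: the flow-free local Gibbs measure at a
general scale, its disintegration, and the Gaussian velocity fluctuations

Support file for the crux `…Theses.RelayRaceLocality.NearConstantShortTimeHL` (stmt-AtomisticToContinuum-12502),
line `means-pin-entropy`, registered stub `stub_concentrationGeneralFamilies : GeneralFamilyConcentration`.
The tree's flow-free local Gibbs measure `localGibbsMeasure σ a u θ N` is tied to the conjunct scaling
`(hsDiameter σ N, N + 1)`; the crux's reference laws are the canonical laws of `n_N` spheres of diameter `ε_N`,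
`(liouville 𝕋³ n ε).withDensity (ofReal ∘ canonicalDensity 𝕋³ ε n (localGibbsProfile a u θ))`. For a GENERAL pair
`(ε, m)` and continuous profiles `a ≥ 0`, `θ > 0`, `u` this file proves, for the measure
`volume.withDensity (ofReal ∘ canonicalDensity 𝕋³ ε m (localGibbsProfile a u θ))` (no new definition is introduced):

* `gf_lintegral_localGibbs` — disintegration into the configurational Gibbs weight `Z⁻¹ 𝟙 ∏ a(xᵢ)` and
  independent Gaussian velocities (`gf_lintegral_posDensity_le_one`: the position density has mass `≤ 1`);
* `gf_localGibbs_velFluct_exp_le` — Chernoff bound `2 e^{-r m}` for the velocity fluctuations (port of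
  `UniformLGC.localGibbsMeasure_velFluct_exp_le`), for every `(ε, m)`, `m ≥ 1`, no smallness needed;
* `gf_localGibbs_velFluct_Kexp` — the same in the rate form `K e^{-n_N/K}` for ALL `N` along any family with
  `1 ≤ n_N` (registered helper `gf_helper_velFluct`).
The position marginal, the density-type events and the momentum/energy bookkeeping are in the stub file
`…GeneralFamilyConcentration.lean`.

Sources: H. Spohn, Large Scale Dynamics of Interacting Particles (1991), Part I §2.3; C. Kipnis – C. Landim (1999),
App. 2; X. Fernique (1970) (Gaussian exponential moments, via Mathlib).
-/

noncomputable section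

namespace Summit.AtomisticToContinuum.HydrodynamicLimit.Theorems.NearConstantShortTimeHL

open MeasureTheory ProbabilityTheory Finset Filter Topology
open scoped ENNReal
open Literature.MathematicalPhysics.KineticTheory Literature.MathematicalPhysics.StatisticalMechanics
open Literature.Analysis.FluidPDE Literature.Analysis.FunctionSpaces
open Literature.Probability.LatticeModels
open Summit.AtomisticToContinuum.HydrodynamicLimit.Theorems.UniformLGC

/-! ### The flow-free local Gibbs measure at a general scale -/

section General

variable {a θ : T3 → ℝ} {u : T3 → V3}

/-- **Disintegration of the flow-free local Gibbs measure at scale `(ε, m)`** (continuous profiles, `a ≥ 0`,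
`θ > 0`): for measurable `G ≥ 0`,
`∫ G dμ = ∫ dx Z⁻¹ 𝟙_{no overlap}(x) ∏ a(xᵢ) ∫ G(x, v) ⊗ᵢ N(u(xᵢ), θ(xᵢ))(dv)`, `Z = posPartition a ε m`. [folklore] -/
theorem gf_lintegral_localGibbs (ha : Continuous a) (hθ : Continuous θ) (hu : Continuous u) (ha0 : ∀ x, 0 ≤ a x)
    (hθ0 : ∀ x, 0 < θ x) (e : ℝ) (m : ℕ) {G : Config m (Fin 3) T3 → ℝ≥0∞} (hG : Measurable G) :
    ∫⁻ z, G z ∂(volume.withDensity fun z =>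
        ENNReal.ofReal (canonicalDensity (Torus.geometry (Fin 3)) e m (localGibbsProfile a u θ) z)) =
      ∫⁻ x, ENNReal.ofReal ((posPartition a e m)⁻¹ * posWeight a e m x) *
        ∫⁻ v, G (zipConfig (x, v)) ∂velMeasure u θ x := by
  set Z := canonicalPartition (Torus.geometry (Fin 3)) e m (localGibbsProfile a u θ) with hZ
  have hZeq : Z = posPartition a e m := canonicalPartition_eq_posPartition ha hθ hu ha0 hθ0 e m
  have hZ0 : 0 ≤ Z⁻¹ := inv_nonneg.2 (canonicalPartition_nonneg _ _ _ (localGibbsProfile_nonneg ha0 fun x => (hθ0 x).le))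
  have hDm : Measurable fun z => ENNReal.ofReal
      (canonicalDensity (Torus.geometry (Fin 3)) e m (localGibbsProfile a u θ) z) :=
    (measurable_canonicalDensity e m (measurable_localGibbsProfile ha hθ hu)).ennreal_ofReal
  calc ∫⁻ z, G z ∂(volume.withDensity fun z =>
          ENNReal.ofReal (canonicalDensity (Torus.geometry (Fin 3)) e m (localGibbsProfile a u θ) z))
      = ∫⁻ z, ENNReal.ofReal (canonicalDensity (Torus.geometry (Fin 3)) e m (localGibbsProfile a u θ) z) * G z := by
        rw [lintegral_withDensity_eq_lintegral_mul _ hDm hG]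
        rfl
    _ = ENNReal.ofReal Z⁻¹ * ∫⁻ z, ENNReal.ofReal ((hardSphereDomain (Torus.geometry (Fin 3)) m e).indicator
          (tensorPow m (localGibbsProfile a u θ)) z) * G z := by
        rw [← lintegral_const_mul' _ _ ENNReal.ofReal_ne_top]
        refine lintegral_congr fun z => ?_
        rw [canonicalDensity, ENNReal.ofReal_mul hZ0, mul_assoc]
    _ = ENNReal.ofReal Z⁻¹ * ∫⁻ x, ENNReal.ofReal (posWeight a e m x) *
          ∫⁻ v, G (zipConfig (x, v)) ∂velMeasure u θ x := by
        rw [lintegral_gibbsWeight_mul ha hθ hu ha0 hθ0 e m hG]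
    _ = _ := by
        rw [← lintegral_const_mul' _ _ ENNReal.ofReal_ne_top]
        refine lintegral_congr fun x => ?_
        rw [← hZeq, ENNReal.ofReal_mul hZ0, mul_assoc]

/-- The marginal position density has total mass `≤ 1` (`= Z⁻¹ Z`). [folklore] -/
theorem gf_lintegral_posDensity_le_one (ha : Continuous a) (ha0 : ∀ x, 0 ≤ a x) (e : ℝ) (m : ℕ) :
    ∫⁻ x, ENNReal.ofReal ((posPartition a e m)⁻¹ * posWeight a e m x) ≤ 1 := by
  have hP0 : 0 ≤ posPartition a e m := posPartition_nonneg ha0 e m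
  simp_rw [ENNReal.ofReal_mul (inv_nonneg.2 hP0)]
  rw [lintegral_const_mul' _ _ ENNReal.ofReal_ne_top, ← ofReal_posPartition ha ha0,
    ← ENNReal.ofReal_mul (inv_nonneg.2 hP0), ← ENNReal.ofReal_one]
  refine ENNReal.ofReal_le_ofReal ?_
  by_cases hZ : posPartition a e m = 0
  · rw [hZ, mul_zero]; exact zero_le_one
  · rw [inv_mul_cancel₀ hZ]

/-- **Exponential concentration of the velocity fluctuations at scale `(ε, m)`** (port of
`UniformLGC.localGibbsMeasure_velFluct_exp_le`): for a jointly measurable family of per-particle velocity observables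
`Y x` centred under `N(u(x), θ(x) id)` with a uniform exponential moment `∫ e^{s₀|Y(x,·)|} ≤ A`, and a continuous
`|χ| ≤ C` (`C > 0`), the flow-free local Gibbs measure of `{δ ≤ |m⁻¹ ∑ᵢ χ(xᵢ) Y(xᵢ, vᵢ)|}` is at most
`2 exp(-r m)`, `r = δ/2 · min(s₀/(2C), δ s₀²/(64 A C²))`, for every `m ≥ 1`. [folklore] -/
theorem gf_localGibbs_velFluct_exp_le (ha : Continuous a) (hθ : Continuous θ) (hu : Continuous u)
    (ha0 : ∀ x, 0 ≤ a x) (hθ0 : ∀ x, 0 < θ x) (e : ℝ) {m : ℕ} (hm : 0 < m)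
    {Y : T3 → V3 → ℝ} (hYm : Measurable fun p : T3 × V3 => Y p.1 p.2)
    (hY0 : ∀ x, ∫ v, Y x v ∂gaussMeasure (u x) (θ x) = 0)
    {s₀ A : ℝ} (hs₀ : 0 < s₀) (hA : 0 < A)
    (hYi : ∀ x, Integrable (fun v => Real.exp (s₀ * |Y x v|)) (gaussMeasure (u x) (θ x)))
    (hYA : ∀ x, ∫ v, Real.exp (s₀ * |Y x v|) ∂gaussMeasure (u x) (θ x) ≤ A)
    {χ : T3 → ℝ} (hχ : Continuous χ) {C : ℝ} (hC0 : 0 < C) (hC : ∀ x, |χ x| ≤ C) {δ : ℝ} (hδ : 0 < δ) :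
    (volume.withDensity fun z =>
        ENNReal.ofReal (canonicalDensity (Torus.geometry (Fin 3)) e m (localGibbsProfile a u θ) z))
        {z | δ ≤ |(m : ℝ)⁻¹ * ∑ i, χ (z i).1 * Y (z i).1 (z i).2|} ≤
      ENNReal.ofReal (2 * Real.exp (-(δ / 2 * min (s₀ / (2 * C)) (δ * s₀ ^ 2 / (64 * A * C ^ 2)) * (m : ℝ)))) := by
  set K₀ := 32 * A * C ^ 2 / s₀ ^ 2 with hK₀
  have hK₀0 : 0 < K₀ := by positivity
  set s := min (s₀ / (2 * C)) (δ * s₀ ^ 2 / (64 * A * C ^ 2)) with hsdef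
  have hs0 : 0 < s := lt_min (by positivity) (by positivity)
  have hsC : s * C ≤ s₀ / 2 := by
    have : s ≤ s₀ / (2 * C) := min_le_left _ _
    rw [le_div_iff₀ (by positivity)] at this; linarith
  have hsK : K₀ * s ≤ δ / 2 := by
    have h1 : s ≤ δ * s₀ ^ 2 / (64 * A * C ^ 2) := min_le_right _ _
    have h2 : δ * s₀ ^ 2 / (64 * A * C ^ 2) = δ / 2 / K₀ := by rw [hK₀]; field_simp; ring
    rw [h2, le_div_iff₀ hK₀0] at h1; linarith
  set E := {z : Config m (Fin 3) T3 | δ ≤ |(m : ℝ)⁻¹ * ∑ i, χ (z i).1 * Y (z i).1 (z i).2|} with hE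
  have hFm : Measurable fun z : Config m (Fin 3) T3 => (m : ℝ)⁻¹ * ∑ i, χ (z i).1 * Y (z i).1 (z i).2 := by
    refine measurable_const.mul (Finset.measurable_sum _ fun i _ => ?_)
    exact (hχ.measurable.comp (measurable_pi_apply i).fst).mul (hYm.comp (measurable_pi_apply i))
  have hEm : MeasurableSet E := measurableSet_le measurable_const hFm.abs
  have hnpos : (0 : ℝ) < (m : ℝ) := by exact_mod_cast hm
  -- per-factor mgf bound, uniformly in the position and for both signs
  have hfactor : ∀ (x : T3) (e' : ℝ), |e'| = 1 →
      Integrable (fun v => Real.exp (s * (e' * (χ x * Y x v)))) (gaussMeasure (u x) (θ x)) ∧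
        ∫ v, Real.exp (s * (e' * (χ x * Y x v))) ∂gaussMeasure (u x) (θ x) ≤ Real.exp (K₀ * s ^ 2) := by
    intro x e' he
    have hYxm : Measurable (Y x) := hYm.comp (measurable_const.prodMk measurable_id)
    have hs' : |s * e' * χ x| ≤ s₀ / 2 := by
      rw [abs_mul, abs_mul, he, mul_one, abs_of_pos hs0]
      exact (mul_le_mul_of_nonneg_left (hC x) hs0.le).trans hsC
    have h := integral_exp_mul_le (gaussMeasure (u x) (θ x)) hYxm (hY0 x) hs₀ (hYi x) (hYA x) hs'
    have heq : (fun v => Real.exp (s * e' * χ x * Y x v)) = fun v => Real.exp (s * (e' * (χ x * Y x v))) := by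
      funext v; ring_nf
    rw [heq] at h
    refine ⟨h.1, h.2.trans (Real.exp_le_exp.2 ?_)⟩
    rw [hK₀]
    have hχ2 : χ x ^ 2 ≤ C ^ 2 := by
      have := hC x; rw [← sq_abs]; exact pow_le_pow_left₀ (abs_nonneg _) this 2
    have he2 : e' ^ 2 = 1 := by rw [← sq_abs, he, one_pow]
    have : (s * e' * χ x) ^ 2 = s ^ 2 * χ x ^ 2 := by rw [mul_pow, mul_pow, he2]; ring
    rw [this]
    have h0 : 0 ≤ 32 * A / s₀ ^ 2 * s ^ 2 := by positivity
    calc 32 * A * (s ^ 2 * χ x ^ 2) / s₀ ^ 2 = 32 * A / s₀ ^ 2 * s ^ 2 * χ x ^ 2 := by ring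
      _ ≤ 32 * A / s₀ ^ 2 * s ^ 2 * C ^ 2 := mul_le_mul_of_nonneg_left hχ2 h0
      _ = 32 * A * C ^ 2 / s₀ ^ 2 * s ^ 2 := by ring
  -- conditional (velocity) bound, uniformly in the positions
  have hvel : ∀ x : Fin m → T3,
      velMeasure u θ x {v | zipConfig (x, v) ∈ E} ≤
        ENNReal.ofReal (2 * Real.exp (-(δ / 2 * s * (m : ℝ)))) := by
    intro x
    have hsplit : {v : Fin m → V3 | zipConfig (x, v) ∈ E} ⊆
        {v | (m : ℝ) * δ ≤ ∑ i, (1 : ℝ) * (χ (x i) * Y (x i) (v i))} ∪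
          {v | (m : ℝ) * δ ≤ ∑ i, (-1 : ℝ) * (χ (x i) * Y (x i) (v i))} := by
      intro v hv
      simp only [hE, Set.mem_setOf_eq, zipConfig_apply] at hv
      simp only [Set.mem_setOf_eq, Set.mem_union, one_mul, neg_one_mul, sum_neg_distrib]
      rcases le_abs.1 hv with h | h
      · left; rw [le_inv_mul_iff₀ hnpos] at h; linarith
      · right
        have h' : δ ≤ (m : ℝ)⁻¹ * -∑ i, χ (x i) * Y (x i) (v i) := by linarith
        rw [le_inv_mul_iff₀ hnpos] at h'; linarith
    refine (measure_mono hsplit).trans ((measure_union_le _ _).trans ?_)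
    have htail : ∀ e' : ℝ, |e'| = 1 →
        velMeasure u θ x {v | (m : ℝ) * δ ≤ ∑ i, e' * (χ (x i) * Y (x i) (v i))} ≤
          ENNReal.ofReal (Real.exp (-(δ / 2 * s * (m : ℝ)))) := by
      intro e' he
      have h := pi_measure_sum_ge_le (fun i => gaussMeasure (u (x i)) (θ (x i)))
        (Z := fun i v => e' * (χ (x i) * Y (x i) v))
        (fun i => measurable_const.mul (measurable_const.mul (hYm.comp (measurable_const.prodMk measurable_id))))
        hs0.le (K := K₀ * s ^ 2) (fun i => hfactor (x i) e' he) ((m : ℝ) * δ)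
      refine (le_of_eq rfl).trans (h.trans (ENNReal.ofReal_le_ofReal (Real.exp_le_exp.2 ?_)))
      rw [Fintype.card_fin]
      have : (m : ℝ) * (K₀ * s ^ 2) ≤ (m : ℝ) * (s * (δ / 2)) := by
        refine mul_le_mul_of_nonneg_left ?_ hnpos.le
        nlinarith
      nlinarith
    calc velMeasure u θ x {v | (m : ℝ) * δ ≤ ∑ i, (1 : ℝ) * (χ (x i) * Y (x i) (v i))} +
          velMeasure u θ x {v | (m : ℝ) * δ ≤ ∑ i, (-1 : ℝ) * (χ (x i) * Y (x i) (v i))}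
        ≤ ENNReal.ofReal (Real.exp (-(δ / 2 * s * (m : ℝ)))) +
            ENNReal.ofReal (Real.exp (-(δ / 2 * s * (m : ℝ)))) :=
          add_le_add (htail 1 (by simp)) (htail (-1) (by simp))
      _ = ENNReal.ofReal (2 * Real.exp (-(δ / 2 * s * (m : ℝ)))) := by
          rw [← ENNReal.ofReal_add (Real.exp_pos _).le (Real.exp_pos _).le, two_mul]
  -- integrate over the positions
  calc (volume.withDensity fun z =>
          ENNReal.ofReal (canonicalDensity (Torus.geometry (Fin 3)) e m (localGibbsProfile a u θ) z)) E
      = ∫⁻ z, E.indicator 1 z ∂(volume.withDensity fun z =>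
          ENNReal.ofReal (canonicalDensity (Torus.geometry (Fin 3)) e m (localGibbsProfile a u θ) z)) :=
        (lintegral_indicator_one hEm).symm
    _ = ∫⁻ x, ENNReal.ofReal ((posPartition a e m)⁻¹ * posWeight a e m x) *
          velMeasure u θ x {v | zipConfig (x, v) ∈ E} := by
        rw [gf_lintegral_localGibbs ha hθ hu ha0 hθ0 e m (measurable_one.indicator hEm)]
        refine lintegral_congr fun x => ?_
        congr 1
        have hpre : MeasurableSet {v : Fin m → V3 | zipConfig (x, v) ∈ E} :=
          hEm.preimage (measurable_zipConfig.comp (measurable_const.prodMk measurable_id))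
        rw [← lintegral_indicator_one hpre]
        rfl
    _ ≤ ∫⁻ x, ENNReal.ofReal ((posPartition a e m)⁻¹ * posWeight a e m x) *
          ENNReal.ofReal (2 * Real.exp (-(δ / 2 * s * (m : ℝ)))) :=
        lintegral_mono fun x => mul_le_mul_right (hvel x) _
    _ ≤ ENNReal.ofReal (2 * Real.exp (-(δ / 2 * s * (m : ℝ)))) := by
        have hρm : Measurable fun x : Fin m → T3 =>
            ENNReal.ofReal ((posPartition a e m)⁻¹ * posWeight a e m x) :=
          (measurable_const.mul (measurable_posWeight ha _ _)).ennreal_ofReal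
        rw [lintegral_mul_const _ hρm]
        exact mul_le_of_le_one_left bot_le (gf_lintegral_posDensity_le_one ha ha0 e m)

end General

/-! ### Velocity fluctuations along a general family -/

section Family

variable {a θ : T3 → ℝ} {u : T3 → V3} {σ : ℝ} {ε : ℕ → ℝ} {n : ℕ → ℕ}

/-- The velocity-fluctuation bound in the form `K e^{-n_N/K}`, for all `N`, along any family with `1 ≤ n_N`
(no smallness is needed: conditionally on the positions the velocities are Gaussian at every scale). [folklore] -/
theorem gf_localGibbs_velFluct_Kexp (ha : Continuous a) (hθ : Continuous θ) (hu : Continuous u)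
    (ha0 : ∀ x, 0 < a x) (hθ0 : ∀ x, 0 < θ x) (hn1 : ∀ N, 1 ≤ n N)
    {Y : T3 → V3 → ℝ} (hYm : Measurable fun p : T3 × V3 => Y p.1 p.2)
    (hY0 : ∀ x, ∫ v, Y x v ∂gaussMeasure (u x) (θ x) = 0)
    (hYexp : ∃ s₀ A : ℝ, 0 < s₀ ∧ 0 < A ∧ ∀ x,
      Integrable (fun v => Real.exp (s₀ * |Y x v|)) (gaussMeasure (u x) (θ x)) ∧
        ∫ v, Real.exp (s₀ * |Y x v|) ∂gaussMeasure (u x) (θ x) ≤ A)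
    {χ : T3 → ℝ} (hχ : Continuous χ) {δ : ℝ} (hδ : 0 < δ) :
    ∃ K : ℝ, 0 < K ∧ ∀ N : ℕ, (volume.withDensity fun z =>
        ENNReal.ofReal (canonicalDensity (Torus.geometry (Fin 3)) (ε N) (n N) (localGibbsProfile a u θ) z))
        {z | δ ≤ |((n N : ℕ) : ℝ)⁻¹ * ∑ i, χ (z i).1 * Y (z i).1 (z i).2|} ≤
      ENNReal.ofReal (K * Real.exp (-(K⁻¹ * (n N : ℝ)))) := by
  obtain ⟨s₀, A, hs₀, hA, hall⟩ := hYexp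
  obtain ⟨C', hC'0, hχC'⟩ := exists_forall_abs_le_of_continuous hχ
  set C := C' + 1 with hC
  have hC0 : 0 < C := by rw [hC]; linarith
  have hχC : ∀ y, |χ y| ≤ C := fun y => (hχC' y).trans (by rw [hC]; linarith)
  set r := δ / 2 * min (s₀ / (2 * C)) (δ * s₀ ^ 2 / (64 * A * C ^ 2)) with hr
  have hr0 : 0 < r := by rw [hr]; exact mul_pos (by positivity) (lt_min (by positivity) (by positivity))
  refine ⟨2 + r⁻¹, by positivity, fun N => ?_⟩
  have h := gf_localGibbs_velFluct_exp_le ha hθ hu (fun x => (ha0 x).le) hθ0 (ε N) (hn1 N) hYm hY0 hs₀ hA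
    (fun x => (hall x).1) (fun x => (hall x).2) hχ hC0 hχC hδ
  refine h.trans (ENNReal.ofReal_le_ofReal ?_)
  have hn : (0 : ℝ) ≤ (n N : ℝ) := Nat.cast_nonneg _
  have := two_exp_le_Kexp hr0 hn
  rw [← hr]
  exact this

end Family

/-! ### Registered helper -/

/-- **Registered helper `gf_helper_velFluct`** (sub-goal of `stub_concentrationGeneralFamilies`): the Gaussian
velocity-fluctuation bound under the flow-free local Gibbs measure along any family with `1 ≤ n_N`,
`gf_localGibbs_velFluct_Kexp` in closed form. [folklore] -/
theorem gf_helper_velFluct :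
    ∀ {a θ : Literature.MathematicalPhysics.KineticTheory.T3 → ℝ}
      {u : Literature.MathematicalPhysics.KineticTheory.T3 → Literature.MathematicalPhysics.KineticTheory.V3}
      {ε : ℕ → ℝ} {n : ℕ → ℕ}, Continuous a → Continuous θ → Continuous u → (∀ x, 0 < a x) → (∀ x, 0 < θ x) →
      (∀ N, 1 ≤ n N) →
      ∀ {Y : Literature.MathematicalPhysics.KineticTheory.T3 → Literature.MathematicalPhysics.KineticTheory.V3 → ℝ},
      (Measurable fun p : Literature.MathematicalPhysics.KineticTheory.T3 ×
          Literature.MathematicalPhysics.KineticTheory.V3 => Y p.1 p.2) →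
      (∀ x, ∫ v, Y x v ∂Literature.MathematicalPhysics.KineticTheory.gaussMeasure (u x) (θ x) = 0) →
      (∃ s₀ A : ℝ, 0 < s₀ ∧ 0 < A ∧ ∀ x,
        MeasureTheory.Integrable (fun v => Real.exp (s₀ * |Y x v|))
            (Literature.MathematicalPhysics.KineticTheory.gaussMeasure (u x) (θ x)) ∧
          ∫ v, Real.exp (s₀ * |Y x v|) ∂Literature.MathematicalPhysics.KineticTheory.gaussMeasure (u x) (θ x) ≤ A) →
      ∀ {χ : Literature.MathematicalPhysics.KineticTheory.T3 → ℝ}, Continuous χ → ∀ {δ : ℝ}, 0 < δ →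
      ∃ K : ℝ, 0 < K ∧ ∀ N : ℕ, (MeasureTheory.volume.withDensity fun z => ENNReal.ofReal
          (Literature.Analysis.FluidPDE.canonicalDensity (Literature.Analysis.FluidPDE.Torus.geometry (Fin 3)) (ε N) (n N)
            (Literature.MathematicalPhysics.KineticTheory.localGibbsProfile a u θ) z))
          {z | δ ≤ |((n N : ℕ) : ℝ)⁻¹ * ∑ i, χ (z i).1 * Y (z i).1 (z i).2|} ≤
        ENNReal.ofReal (K * Real.exp (-(K⁻¹ * (n N : ℝ)))) :=
  fun ha hθ hu ha0 hθ0 hn1 _ hYm hY0 hYexp _ hχ _ hδ =>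
    gf_localGibbs_velFluct_Kexp ha hθ hu ha0 hθ0 hn1 hYm hY0 hYexp hχ hδ

end Summit.AtomisticToContinuum.HydrodynamicLimit.Theorems.NearConstantShortTimeHL

end
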